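import Literature.NumberTheory.EllipticCurves.ModFiveImageSplitCartanJLineProofs
import Literature.NumberTheory.EllipticCurves.ModFiveImageCubicFieldCriterionProofs
import HarnessLib

/-!
# Zywina 2015, Theorem 1.4 (ℓ = 5), second item for `G₉` (the exceptional group `⊃ N_s(5)`,
# `J₉(t) = t³(t²+5t+40)`): a non-CM `E/ℚ` with `j(E) = J₉(t)` has `ρ̄_{E,5}` NOT surjective —
# DISCHARGE of the named fact `zywina2015_thm14_not_surjective_five_of_j_eq_J9`

THEOREMS ONLY (no definition, no new named fact). `G₉ ⊂ GL₂(𝔽₅)` (index `5`, image `𝔖₄` in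
`PGL₂(𝔽₅)`) contains the split Cartan normaliser `N_s(5)` with index `3`; on modular curves,
`X_{N_s(5)} → X_{G₉}` is the degree-`3` map `t = φ(u) = (u+5)(u²−5)/(u²+5u+5)` with
`J₉(φ(u)) = J₄(u)` (checked below by `ring`). Hence for `j(E) = J₉(t)`, `t ∈ ℚ`, every root `u ∈
    ℚ̄` of
the rational cubic `(X+5)(X²−5) − t(X²+5X+5)` satisfies `j(E) = J₄(u)`, and over the cubic field
`ℚ⟮u⟯` the `N_s(5)` machinery of `ModFiveImageSplitCartanJLineProofs.lean` produces a degree-`4`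
factor of `ψ₅` with coefficients in `ℚ⟮u⟯`; the cubic-field criterion
(`ModFiveImageCubicFieldCriterionProofs.lean`: unipotents of `GL₂(𝔽₅)` are sixth powers, and the
sixth power of any `τ ∈ Γ_ℚ` fixes a root of a cubic) then forbids surjectivity. Consumers: the X9
certificate records of image type `5S4`
(`Summits/BirchSwinnertonDyer/Rank1Residual/X9/PrintCertImage.lean`,
hypothesis `h5e`).

References: D. Zywina, arXiv:1508.07660 (2015), §1.3 (`G₉`, `J₉`) and Thm. 1.4; J.-P. Serre,
Invent. Math. 15 (1972) §2; J. H. Silverman, *AEC* (2009), III.§1, Exercise 3.7.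
-/

noncomputable section

open scoped Classical IntermediateField
open Polynomial WeierstrassCurve

namespace Literature.NumberTheory.EllipticCurves

open Zywina2015SplitCartanFive

/-- **Discharge of `zywina2015_thm14_not_surjective_five_of_j_eq_J9`** (Zywina 2015, Thm. 1.4,
second
item for `i = 9`: the exceptional `G₉ ⊃ N_s(5)`, `J₉(t) = t³(t²+5t+40)`): a non-CM elliptic `W/ℚ`
with
`j(W) = t³(t²+5t+40)` has `ρ̄_{W,5}` NOT surjective — via a root `u` of `(X+5)(X²−5) − t(X²+5X+5)`,
the `N_s(5)` factor of `ψ₅` over `ℚ⟮u⟯`, and the cubic-field criterion at `5`.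
[cite: Zywina2015, Thm. 1.4 (second item, i = 9) and §1.3 (G₉, J₉) (arXiv:1508.07660 pp. 4–5)]
[cite: Serre1972, §2.1] [cite: SilvermanAEC2009, Exercise 3.7 (f)] -/
theorem zywina2015_thm14_not_surjective_five_of_j_eq_J9_holds :
    zywina2015_thm14_not_surjective_five_of_j_eq_J9 := by
  intro W _ hCM t hj
  have hj0 : W.j ≠ 0 := fun h ↦ hCM (hasCM_of_j_eq_zero W h)
  have hj1728 : W.j ≠ 1728 := fun h ↦ hCM (hasCM_of_j_eq_1728 W h)
  -- the short model `E : y² = x³ + A x + B` over `ℚ`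
  obtain ⟨A, hA⟩ : ∃ A : ℚ, A = -W.c₄ / 48 := ⟨_, rfl⟩
  obtain ⟨B, hB⟩ : ∃ B : ℚ, B = -W.c₆ / 864 := ⟨_, rfl⟩
  have hc4 : W.c₄ ≠ 0 := fun h ↦ hj0 (W.j_eq_zero h)
  have hA0 : A ≠ 0 := by rw [hA]; exact div_ne_zero (neg_ne_zero.mpr hc4) (by norm_num)
  have hjΔ : W.j * W.Δ = W.c₄ ^ 3 := by
    rw [WeierstrassCurve.j, ← coe_Δ', mul_comm, ← mul_assoc, Units.mul_inv, one_mul]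
  have hcr := W.c_relation
  -- (E1): `j · (4A³ + 27B²) = 6912 A³`
  have hE1 : W.j * (4 * A ^ 3 + 27 * B ^ 2) = 6912 * A ^ 3 := by
    rw [hA, hB]; linear_combination (-(1 : ℚ) / 16) * hjΔ + (W.j / 27648) * hcr
  obtain ⟨E, hE⟩ : ∃ E : WeierstrassCurve ℚ, E = ⟨0, 0, 0, A, B⟩ := ⟨_, rfl⟩
  have hCE : (⟨1, -W.b₂ / 12, -W.a₁ / 2, -(W.a₃ - W.a₁ * W.b₂ / 12) / 2⟩ : VariableChange ℚ) • W =
      E := by rw [shortModel_smul_eq W, hE, hA, hB]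
  haveI : E.IsElliptic := hCE ▸ inferInstance
  -- the cubic `c = (X+5)(X²−5) − t(X²+5X+5)` and a root `u ∈ ℚ̄`
  obtain ⟨c, hc⟩ : ∃ c : ℚ[X], c = X ^ 3 + C (5 - t) * X ^ 2 + C (-(5 + 5 * t)) * X +
    C (-(25 + 5 * t)) := ⟨_, rfl⟩
  have hcdeg : c.natDegree = 3 := by rw [hc]; compute_degree!
  have hc0 : c ≠ 0 := ne_zero_of_natDegree_gt (n := 0) (by omega)
  obtain ⟨u, hu⟩ := IsAlgClosed.exists_root (c.map (algebraMap ℚ (AlgebraicClosure ℚ))) (by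
    rw [degree_map, degree_eq_natDegree hc0, hcdeg]; norm_num)
  have hcu : aeval u c = 0 := by rwa [IsRoot.def, eval_map, ← aeval_def] at hu
  -- the cubic field `K₁ = ℚ⟮u⟯` and `u₁ = u ∈ K₁`
  set K₁ : IntermediateField ℚ (AlgebraicClosure ℚ) := ℚ⟮u⟯ with hK₁
  obtain ⟨u₁, hu₁⟩ : ∃ u₁ : K₁, (u₁ : AlgebraicClosure ℚ) = u :=
    ⟨⟨u, IntermediateField.mem_adjoin_simple_self ℚ u⟩, rfl⟩
  have hcu₁ : aeval u₁ c = 0 := by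
    apply (algebraMap K₁ (AlgebraicClosure ℚ)).injective
    rw [← Polynomial.aeval_algebraMap_apply, map_zero,
      show algebraMap K₁ (AlgebraicClosure ℚ) u₁ = u from hu₁]
    exact hcu
  -- arithmetic in `K₁`
  set tK : K₁ := algebraMap ℚ K₁ t with htK
  set jK : K₁ := algebraMap ℚ K₁ W.j with hjK
  set AK : K₁ := algebraMap ℚ K₁ A with hAK
  set BK : K₁ := algebraMap ℚ K₁ B with hBK
  have hinj : Function.Injective (algebraMap ℚ K₁) := (algebraMap ℚ K₁).injective
  have hrel : (u₁ + 5) * (u₁ ^ 2 - 5) = tK * (u₁ ^ 2 + 5 * u₁ + 5) := by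
    rw [hc] at hcu₁
    simp only [map_add, map_mul, map_pow, aeval_X, aeval_C, map_sub, map_neg, map_ofNat] at hcu₁
    rw [htK]; linear_combination hcu₁
  -- `Den(u₁) ≠ 0`
  have hDen : u₁ ^ 2 + 5 * u₁ + 5 ≠ 0 := by
    intro hD
    have h1 : (u₁ + 5) * (u₁ ^ 2 - 5) = 0 := by rw [hrel, hD, mul_zero]
    have h2 : -5 * (2 * u₁ + 5) = 0 := by linear_combination h1 - u₁ * hD
    have h3 : 2 * u₁ + 5 = 0 := (mul_eq_zero.mp h2).resolve_left (by norm_num)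
    have h4 : (2 * u₁ + 5) ^ 2 - 5 = 0 := by linear_combination 4 * hD
    rw [h3] at h4
    norm_num at h4
  -- `j · Den⁵ = m³` in `K₁`
  have hjt : jK = tK ^ 3 * (tK ^ 2 + 5 * tK + 40) := by
    rw [hjK, hj, htK]; simp only [map_mul, map_pow, map_add, map_ofNat]
  have hjD : jK * (u₁ ^ 2 + 5 * u₁ + 5) ^ 5 =
      ((u₁ + 5) * (u₁ ^ 2 - 5) * (u₁ ^ 2 + 5 * u₁ + 10)) ^ 3 := by
    rw [hjt]
    calc tK ^ 3 * (tK ^ 2 + 5 * tK + 40) * (u₁ ^ 2 + 5 * u₁ + 5) ^ 5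
        = (tK * (u₁ ^ 2 + 5 * u₁ + 5)) ^ 3 * ((tK * (u₁ ^ 2 + 5 * u₁ + 5)) ^ 2 +
            5 * (tK * (u₁ ^ 2 + 5 * u₁ + 5)) * (u₁ ^ 2 + 5 * u₁ + 5) +
            40 * (u₁ ^ 2 + 5 * u₁ + 5) ^ 2) := by ring
      _ = ((u₁ + 5) * (u₁ ^ 2 - 5)) ^ 3 * (((u₁ + 5) * (u₁ ^ 2 - 5)) ^ 2 +
            5 * ((u₁ + 5) * (u₁ ^ 2 - 5)) * (u₁ ^ 2 + 5 * u₁ + 5) +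
            40 * (u₁ ^ 2 + 5 * u₁ + 5) ^ 2) := by rw [← hrel]
      _ = ((u₁ + 5) * (u₁ ^ 2 - 5) * (u₁ ^ 2 + 5 * u₁ + 10)) ^ 3 := by ring
  -- (E1) in `K₁` and the `j`-relation for `key_relation`
  have hE1K : jK * (4 * AK ^ 3 + 27 * BK ^ 2) = 6912 * AK ^ 3 := by
    rw [hjK, hAK, hBK]
    have := congrArg (algebraMap ℚ K₁) hE1
    simpa only [map_mul, map_add, map_pow, map_ofNat] using this
  have hjrel : 6912 * AK ^ 3 * (u₁ ^ 2 + 5 * u₁ + 5) ^ 5 =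
      ((u₁ + 5) * (u₁ ^ 2 - 5) * (u₁ ^ 2 + 5 * u₁ + 10)) ^ 3 * (4 * AK ^ 3 + 27 * BK ^ 2) := by
    rw [← hjD, ← hE1K]; ring
  have hkey := key_relation u₁ AK BK hjrel
  -- `A ≠ 0`, `j ≠ 1728` in `K₁`; `q(u₁) r(u₁) ≠ 0`
  have hAK0 : AK ≠ 0 := by rw [hAK]; exact (map_ne_zero_iff _ hinj).mpr hA0
  have hjK1728 : jK ≠ 1728 := by
    rw [hjK, show (1728 : K₁) = algebraMap ℚ K₁ 1728 from (map_ofNat _ 1728).symm]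
    exact fun h ↦ hj1728 (hinj h)
  have hqr : (u₁ + 2) * (u₁ ^ 2 - 20) *
      (u₁ ^ 6 + 14 * u₁ ^ 5 + 79 * u₁ ^ 4 + 240 * u₁ ^ 3 + 515 * u₁ ^ 2 + 850 * u₁ + 725) ^ 2 ≠ 0
          := by
    intro h0
    apply hjK1728
    have : (jK - 1728) * (u₁ ^ 2 + 5 * u₁ + 5) ^ 5 = 0 := by linear_combination hjD + h0
    exact sub_eq_zero.mp ((mul_eq_zero.mp this).resolve_right (pow_ne_zero 5 hDen))
  obtain ⟨hq0, hr0⟩ := mul_ne_zero_iff.mp hqr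
  have hbT : (-54 * ((u₁ + 2) * (u₁ ^ 2 - 20)) ^ 2 *
      (u₁ ^ 6 + 14 * u₁ ^ 5 + 79 * u₁ ^ 4 + 240 * u₁ ^ 3 + 515 * u₁ ^ 2 + 850 * u₁ + 725)) ≠ 0 :=
    mul_ne_zero (mul_ne_zero (by norm_num) (pow_ne_zero 2 hq0))
      (fun h ↦ hr0 (by rw [h, zero_pow two_ne_zero]))
  obtain ⟨σ₁, hAσ, hBσ⟩ := exists_twist_param u₁ AK BK hAK0 hbT hkey
  -- the degree-4 factor of `ψ₅` over `K₁`
  obtain ⟨g, h, hgdeg, hfac, -⟩ := exists_factor_preΨ_five u₁ σ₁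
  have hEK : E.baseChange K₁ =
      ⟨0, 0, 0, (-27 * ((u₁ + 5) * (u₁ ^ 2 - 5) * (u₁ ^ 2 + 5 * u₁ + 10)) *
        ((u₁ + 2) * (u₁ ^ 2 - 20))) * σ₁ ^ 2,
        (-54 * ((u₁ + 2) * (u₁ ^ 2 - 20)) ^ 2 *
          (u₁ ^ 6 + 14 * u₁ ^ 5 + 79 * u₁ ^ 4 + 240 * u₁ ^ 3 + 515 * u₁ ^ 2 + 850 * u₁ + 725)) *
          σ₁ ^ 3⟩ := by
    rw [← hAσ, ← hBσ, hE, hAK, hBK]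
    ext <;> simp [baseChange]
  have hdvd : g ∣ (E.baseChange K₁).preΨ ((5 : ℕ) : ℤ) := Dvd.intro h (by rw [hEK, hfac])
  have hns : ¬ E.HasSurjectiveModNGaloisRep ((5 : ℕ) : ℤ) :=
    E.not_hasSurjectiveModNGaloisRep_five_of_dvd_preΨ_cubic c hc0 (by omega) hcu g
      (by omega) (by omega) hdvd
  -- transport back to `W`
  intro hW
  apply hns
  rw [← hCE]
  exact (hasSurjectiveModNGaloisRep_smul_iff W _ ((5 : ℕ) : ℤ)).mpr (by exact_mod_cast hW)

end Literature.NumberTheory.EllipticCurves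

end
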